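import Summits.QuantumFields.GaugeBoot.TwistedSlabHaar
import Literature.MathematicalPhysics.QuantumFieldTheory.LatticeRPMechanism
import HarnessLib

/-!
# Block substitutions and one-variable elimination under the product Haar measure (gauge-boot, L3 negative supplement; twisted-slab mechanism 2/4)

HONEST FRAMING (cell `pub-gaugeboot`, page 1 of every file): the venture produces certified bounds
on lattice expectations at stated coupling, gauge group, dimension and torus size; NOT a mass gap,
NOT a continuum limit, NOT a string tension; NOT Yang–Mills-summit-bearing (barriers
`FixedCouplingUltralocality`, `PerturbativeInvisibility`). Bookkeeping for the NEGATIVE result of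
`TiltedBoxOddAxisRPNegative.lean`.

Setting: the product Haar measure `μ = productHaar A d G` on configurations `Config A d G = Link A d → G`
of a periodic lattice, a continuous representation `ρ`, a continuous weight `w` with
`∫ w(k) φ(k)_{ab} dk = c δ_{ab}` (`φ = ρ` or `ρ ∘ inv`, `TwistedSlabHaar.lean`), and a finite block `S`
of links.

* `slabSubst S a b` — the substitution `Y_t ↦ b_t Y_t⁻¹ a_t` (`t ∈ S`) with constants
  `a_t, b_t ∈ G`; it preserves `μ` (`measurePreserving_slabSubst`: inversion invariance and two-sided
  invariance of Haar measure, link by link); `weightArg_slabSubst`: `a_t (b_t Y_t⁻¹ a_t)⁻¹ b_t = Y_t`;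
* **`integral_weight_entry_step`** — the one-variable elimination step: for `s ∉ T` and `R`, `W`
  continuous and depending only on the `T`-coordinates,
  `∫ w(Y_s) W(Y) tr(K φ(Y_s) R(Y)) dμ = c ∫ W(Y) tr(K R(Y)) dμ` (independence of disjoint coordinate
  blocks, `LatticeRP.integral_mul_eq_of_dependsOn`, and the one-link marginal);
* `integral_prod_weight` — `∫ ∏_{t ∈ S} w(Y_t) dμ = z^{|S|}`, `z = ∫ w dk`.

The slab integral itself (four eliminations in a row) is `TwistedSlabIntegral.lean`.
Everything is `[folklore]` (Fubini and invariance of Haar measure; no character expansion).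

References: K. Osterwalder, E. Seiler, Ann. Phys. 110 (1978) 440, §2; T. Bröcker, T. tom Dieck,
GTM 98 (1985), II §4.
-/

noncomputable section

open MeasureTheory Complex
open scoped Matrix ComplexConjugate
open Literature.MathematicalPhysics.QuantumFieldTheory (haarProbability)
open Literature.MathematicalPhysics.QuantumFieldTheory.LatticeRP (integral_mul_eq_of_dependsOn
  integral_comp_eq_of_measurePreserving)
open Literature.RepresentationTheory.CompactGroups

namespace Summit.QuantumFields.GaugeBoot

namespace TwistedSlab

open TiltedRP

variable {A : Type*} [Fintype A] [DecidableEq A] {d N : ℕ}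
variable {G : Type*} [Group G] [TopologicalSpace G] [IsTopologicalGroup G] [CompactSpace G]
  [MeasurableSpace G] [BorelSpace G] [SecondCountableTopology G] (ρ : G →* Matrix (Fin N) (Fin N) ℂ)

/-! ## Integrability on the compact configuration space -/

/-- The product Haar measure of the periodic lattice is a probability measure (instance form of
`isProbabilityMeasure_productHaar`). [folklore] -/
instance isProbabilityMeasure_productHaar' : IsProbabilityMeasure (productHaar A d G) :=
  isProbabilityMeasure_productHaar

omit [DecidableEq A] in
/-- Continuous functions of the configuration are integrable for the product Haar measure (compact
configuration space, finite measure). [folklore] -/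
theorem integrable_config_of_continuous {E : Type*} [NormedAddCommGroup E] {f : Config A d G → E}
    (hf : Continuous f) : Integrable f (productHaar A d G) :=
  hf.integrable_of_hasCompactSupport (HasCompactSupport.of_compactSpace f)

omit [Fintype A] [DecidableEq A] [IsTopologicalGroup G] [CompactSpace G] [MeasurableSpace G] [BorelSpace G]
  [SecondCountableTopology G] in
/-- Entries of `ρ` of a link variable are continuous in the configuration. [folklore] -/
theorem continuous_entry_apply (hρ : Continuous ρ) (t : Link A d) (a b : Fin N) :
    Continuous fun Y : Config A d G => ρ (Y t) a b :=
  CompactGroup.continuous_entry (hρ.comp (continuous_apply t)) a b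

/-! ## The substitution `Y_t ↦ b_t Y_t⁻¹ a_t` on a block of links -/

/-- **The slab substitution**: `Y_t ↦ b_t Y_t⁻¹ a_t` for `t ∈ S`, identity on the other links.
[folklore] -/
def slabSubst (S : Finset (Link A d)) (a b : Link A d → G) (Y : Config A d G) : Config A d G :=
  fun t => if t ∈ S then b t * (Y t)⁻¹ * a t else Y t

omit [Fintype A] [TopologicalSpace G] [IsTopologicalGroup G] [CompactSpace G] [MeasurableSpace G]
  [BorelSpace G] [SecondCountableTopology G] in
/-- The substitution on a link of the block. [folklore] -/
theorem slabSubst_apply_of_mem (S : Finset (Link A d)) (a b : Link A d → G) (Y : Config A d G)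
    {t : Link A d} (ht : t ∈ S) : slabSubst S a b Y t = b t * (Y t)⁻¹ * a t := by
  simp [slabSubst, ht]

omit [Fintype A] [TopologicalSpace G] [IsTopologicalGroup G] [CompactSpace G] [MeasurableSpace G]
  [BorelSpace G] [SecondCountableTopology G] in
/-- The substitution off the block. [folklore] -/
theorem slabSubst_apply_of_not_mem (S : Finset (Link A d)) (a b : Link A d → G) (Y : Config A d G)
    {t : Link A d} (ht : t ∉ S) : slabSubst S a b Y t = Y t := by
  simp [slabSubst, ht]

omit [Fintype A] [TopologicalSpace G] [IsTopologicalGroup G] [CompactSpace G] [MeasurableSpace G]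
  [BorelSpace G] [SecondCountableTopology G] in
/-- The weight factor after the substitution: `a_t (b_t Y_t⁻¹ a_t)⁻¹ b_t = a_t a_t⁻¹ Y_t b_t⁻¹ b_t = Y_t`
up to conjugation — precisely `a (b Y⁻¹ a)⁻¹ b = (a a⁻¹) Y (b⁻¹ b) = Y`. [folklore] -/
theorem weightArg_slabSubst (S : Finset (Link A d)) (a b : Link A d → G) (Y : Config A d G)
    {t : Link A d} (ht : t ∈ S) : a t * (slabSubst S a b Y t)⁻¹ * b t = Y t := by
  rw [slabSubst_apply_of_mem S a b Y ht]
  group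

omit [SecondCountableTopology G] in
/-- **The slab substitution preserves the product Haar measure** (link by link: inversion
invariance and two-sided invariance of Haar measure on the compact group). [folklore] -/
theorem measurePreserving_slabSubst (S : Finset (Link A d)) (a b : Link A d → G) :
    MeasurePreserving (slabSubst S a b) (productHaar A d G) (productHaar A d G) := by
  unfold productHaar
  have h := measurePreserving_pi (fun _ : Link A d => haarProbability G)
    (fun _ : Link A d => haarProbability G)
    (f := fun t (g : G) => if t ∈ S then b t * g⁻¹ * a t else g) (fun t => ?_)
  · exact h
  · by_cases ht : t ∈ S
    · simp only [ht, if_true]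
      exact (measurePreserving_mul_right (haarProbability G) (a t)).comp
        ((measurePreserving_mul_left (haarProbability G) (b t)).comp
          (Measure.measurePreserving_inv (haarProbability G)))
    · simp only [ht, if_false]
      exact MeasurePreserving.id _

/-! ## The one-variable elimination step -/

/-- **Elimination of one block variable.** Let `φ : G → Matrix` be continuous with
`∫ w(k) φ(k)_{ab} dk = c δ_{ab}`, let `s ∉ T`, and let the matrix function `R` and the scalar
function `W` be continuous and depend only on the `T`-coordinates. Then
`∫ w(Y_s) W(Y) tr(K φ(Y_s) R(Y)) dμ = c ∫ W(Y) tr(K R(Y)) dμ`. [folklore] -/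
theorem integral_weight_entry_step {w : G → ℝ} (hw : Continuous w) {c : ℂ}
    {φ : G → Matrix (Fin N) (Fin N) ℂ} (hφ : Continuous φ)
    (hφc : ∀ a b, ∫ k, (w k : ℂ) * φ k a b ∂(haarProbability G) = if a = b then c else 0)
    (s : Link A d) (T : Finset (Link A d)) (hs : s ∉ T) (K : Matrix (Fin N) (Fin N) ℂ)
    (R : Config A d G → Matrix (Fin N) (Fin N) ℂ) (W : Config A d G → ℂ)
    (hRc : ∀ a b, Continuous fun Y => R Y a b) (hRT : ∀ a b, DependsOn (fun Y => R Y a b) (T : Set _))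
    (hWc : Continuous W) (hWT : DependsOn W (T : Set _)) :
    ∫ Y, (w (Y s) : ℂ) * W Y * (K * φ (Y s) * R Y).trace ∂(productHaar A d G) =
      c * ∫ Y, W Y * (K * R Y).trace ∂(productHaar A d G) := by
  -- continuity / integrability bookkeeping
  have hws : Continuous fun Y : Config A d G => (w (Y s) : ℂ) :=
    continuous_ofReal.comp (hw.comp (continuous_apply s))
  have hφs : ∀ a b, Continuous fun Y : Config A d G => φ (Y s) a b :=
    fun a b => CompactGroup.continuous_entry (hφ.comp (continuous_apply s)) a b
  have hf : ∀ x e : Fin N, Continuous fun Y : Config A d G => (w (Y s) : ℂ) * φ (Y s) x e :=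
    fun x e => hws.mul (hφs x e)
  have hg : ∀ e x : Fin N, Continuous fun Y : Config A d G => W Y * R Y e x :=
    fun e x => hWc.mul (hRc e x)
  -- expand the trace entrywise
  have hexp : ∀ Y : Config A d G, (w (Y s) : ℂ) * W Y * (K * φ (Y s) * R Y).trace =
      ∑ x, ∑ e, ∑ y, K x y * ((w (Y s) : ℂ) * φ (Y s) y e) * (W Y * R Y e x) := by
    intro Y
    simp only [Matrix.trace, Matrix.diag_apply, Matrix.mul_apply, Finset.mul_sum, Finset.sum_mul]
    exact Finset.sum_congr rfl fun x _ => Finset.sum_congr rfl fun e _ =>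
      Finset.sum_congr rfl fun y _ => by ring
  have hexp' : ∀ Y : Config A d G, W Y * (K * R Y).trace = ∑ x, ∑ e, K x e * (W Y * R Y e x) := by
    intro Y
    simp only [Matrix.trace, Matrix.diag_apply, Matrix.mul_apply, Finset.mul_sum]
    exact Finset.sum_congr rfl fun x _ => Finset.sum_congr rfl fun e _ => by ring
  simp_rw [hexp, hexp']
  -- integrate term by term
  have hint : ∀ x e y, Integrable (fun Y : Config A d G =>
      K x y * ((w (Y s) : ℂ) * φ (Y s) y e) * (W Y * R Y e x)) (productHaar A d G) :=
    fun x e y => integrable_config_of_continuous ((continuous_const.mul (hf y e)).mul (hg e x))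
  have hint' : ∀ x e, Integrable (fun Y : Config A d G => K x e * (W Y * R Y e x)) (productHaar A d G) :=
    fun x e => integrable_config_of_continuous (continuous_const.mul (hg e x))
  rw [integral_finsetSum _ fun x _ => integrable_finsetSum _ fun e _ =>
    integrable_finsetSum _ fun y _ => hint x e y]
  rw [integral_finsetSum _ fun x _ => integrable_finsetSum _ fun e _ => hint' x e, Finset.mul_sum]
  refine Finset.sum_congr rfl fun x _ => ?_
  rw [integral_finsetSum _ fun e _ => integrable_finsetSum _ fun y _ => hint x e y,
    integral_finsetSum _ fun e _ => hint' x e, Finset.mul_sum]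
  refine Finset.sum_congr rfl fun e _ => ?_
  rw [integral_finsetSum _ fun y _ => hint x e y]
  -- independence of the `{s}`-block and the `T`-block
  have hind : ∀ y, ∫ Y, K x y * ((w (Y s) : ℂ) * φ (Y s) y e) * (W Y * R Y e x) ∂(productHaar A d G) =
      K x y * ((∫ Y, (w (Y s) : ℂ) * φ (Y s) y e ∂(productHaar A d G)) *
        ∫ Y, W Y * R Y e x ∂(productHaar A d G)) := by
    intro y
    have hfg : ∀ Y : Config A d G, K x y * ((w (Y s) : ℂ) * φ (Y s) y e) * (W Y * R Y e x) =
        K x y * (((w (Y s) : ℂ) * φ (Y s) y e) * (W Y * R Y e x)) := fun Y => by ring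
    simp_rw [hfg]
    rw [integral_const_mul]
    congr 1
    unfold productHaar
    exact integral_mul_eq_of_dependsOn (haarProbability G) {s} T
      (Finset.disjoint_singleton_left.2 hs) (hf y e).measurable (hg e x).measurable
      (fun Y Y' h => by rw [h s (by simp)])
      (fun Y Y' h => by
        show W Y * R Y e x = W Y' * R Y' e x
        rw [hWT h]
        congr 1
        exact hRT e x h)
  simp_rw [hind]
  -- the one-link integral
  have hone : ∀ y, ∫ Y, (w (Y s) : ℂ) * φ (Y s) y e ∂(productHaar A d G) = if y = e then c else 0 := by
    intro y
    rw [← hφc y e]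
    unfold productHaar
    exact integral_comp_eq_of_measurePreserving (measurePreserving_eval (fun _ : Link A d => haarProbability G) s)
      (Φ := fun k : G => (w k : ℂ) * φ k y e)
      (show Continuous (fun k : G => (w k : ℂ) * φ k y e) from
        (continuous_ofReal.comp hw).mul (CompactGroup.continuous_entry hφ y e)).measurable
  simp_rw [hone]
  simp only [mul_ite, mul_zero, ite_mul, zero_mul, Finset.sum_ite_eq', Finset.mem_univ, if_true]
  rw [integral_const_mul]
  ring

/-! ## Products of independent weights -/

/-- **`∫ ∏_{t ∈ S} w(Y_t) dμ = (∫ w dk)^{|S|}`** (independent links). [folklore] -/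
theorem integral_prod_weight {w : G → ℝ} (hw : Continuous w) (S : Finset (Link A d)) :
    ∫ Y, ∏ t ∈ S, (w (Y t) : ℂ) ∂(productHaar A d G) =
      (∫ k, (w k : ℂ) ∂(haarProbability G)) ^ S.card := by
  induction S using Finset.induction_on with
  | empty => simp
  | @insert t S ht ih =>
    rw [Finset.card_insert_of_notMem ht, pow_succ']
    simp_rw [Finset.prod_insert ht]
    have hf : Continuous fun Y : Config A d G => (w (Y t) : ℂ) :=
      continuous_ofReal.comp (hw.comp (continuous_apply t))
    have hg : Continuous fun Y : Config A d G => ∏ u ∈ S, (w (Y u) : ℂ) :=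
      continuous_finsetProd _ fun u _ => continuous_ofReal.comp (hw.comp (continuous_apply u))
    have hind : ∫ Y, (w (Y t) : ℂ) * ∏ u ∈ S, (w (Y u) : ℂ) ∂(productHaar A d G) =
        (∫ Y, (w (Y t) : ℂ) ∂(productHaar A d G)) * ∫ Y, ∏ u ∈ S, (w (Y u) : ℂ) ∂(productHaar A d G) := by
      unfold productHaar
      exact integral_mul_eq_of_dependsOn (haarProbability G) {t} S
        (Finset.disjoint_singleton_left.2 ht) hf.measurable hg.measurable
        (fun Y Y' h => by rw [h t (by simp)])
        (fun Y Y' h => Finset.prod_congr rfl fun u hu => by rw [h u (by simpa using hu)])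
    rw [hind, ih]
    congr 1
    unfold productHaar
    exact integral_comp_eq_of_measurePreserving (measurePreserving_eval (fun _ : Link A d => haarProbability G) t)
      (Φ := fun k : G => (w k : ℂ))
      (show Continuous (fun k : G => (w k : ℂ)) from continuous_ofReal.comp hw).measurable

end TwistedSlab

end Summit.QuantumFields.GaugeBoot

end
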